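import Literature.NumberTheory.GaloisRepresentations.LubinTateColemanRelativeExactPrincipalTwo
import HarnessLib

/-!
# The anomaly cokernel `𝒪_E/(1 − uφ)𝒪_E` over an unramified base is a CYCLIC `𝒪_F`-module
# (de Shalit I §3.7: the cokernel `(𝒪/p^N)(1)` of Theorem I.3.7), and the cokernel of `β ↦ r_β` at `q = 2`

De Shalit, *Iwasawa theory of elliptic curves with complex multiplication* (1987), Ch. I §3.7 Theorem: over the unramified base
`k' = E` the sequence `0 → 𝒰 ⊗̂ 𝒪 → Λ(𝒢, 𝒪) → (𝒪/p^N)(1) → 0` is exact, the cokernel being CYCLIC of order `p^N`,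
`p^N ∥ p^dξ^{-1} − 1`.  In the coordinates `r_β ∈ 𝒪_E⟦Y⟧` of the tree (`LubinTateColemanRelativeExact(Principal)Two`: image of
`β ↦ r_β` `=` `{r : r(0) ∈ (1 − uφ)𝒪_E}`, `π = 2u`) the cokernel is `𝒪_E/(1 − uφ)𝒪_E`; this file proves that it is generated by ONE
element over `𝒪_F` — for any finite `E ⊆ F^{nr}`, any ring endomorphism `ψ` of `𝒪_E` over `𝒪_F` with `ψ(c) ≡ c^q (mod π)` and any
`u ∈ 𝒪_F`.  Everything PROVED (0 sorry, no named facts):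

* `exists_forall_sub_mem_pow` — Cauchy sequences for the `I`-adic filtration converge in an `I`-adically precomplete ring.
* `finite_quotient_span_pi` — `𝒪_E/π𝒪_E` is finite (`𝒪_E` compact, `π𝒪_E = {‖x‖ < 1}` open); `pow_residueFieldCard_sub_mem`
  (`a^q ≡ a (mod 𝔪_F)`).
* ★ `exists_forall_exists_sub_mem_span` — **mod `π`**: there is `c̄₀` with `𝓀_E = 𝓀_F·c̄₀ + (1 − ū·Frob_q)𝓀_E` (the kernel of
  `1 − ū·Frob_q` on the field `𝓀_E` consists of roots of `ūX^q − X`, so has `≤ q` elements; hence the cokernel has `≤ q = |𝓀_F|`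
  elements and is generated by any non-zero class over `𝓀_F`).
* ★★ `exists_forall_exists_eq_add_sub_mul` — **`𝒪_E = 𝒪_F·c₀ + (1 − uψ)𝒪_E` for some `c₀ ∈ 𝒪_E`** (lift by `π`-adic completeness of
  `𝒪_E` and `𝔪`-adic completeness of `𝒪_F`): the anomaly cokernel `𝒪_E/(1 − uψ)𝒪_E` is a cyclic `𝒪_F`-module.
* ★★ `exists_principal_relUnitCoordTwo_eq_sub_C` (`q = 2`, `π = 2u`, `E ⊆ F^{nr}` finite Galois with Frobenius `φ`) — **there is
  `c₀ ∈ 𝒪_E` such that every `r ∈ 𝒪_E⟦Y⟧` is `a·c₀ + r_β` for some `a ∈ 𝒪_F` and a principal norm-coherent unit `β`**: the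
  cokernel of Theorem I.3.7 `𝒪_E⟦Y⟧ / r(𝒰¹(E·K_π^∞))` is cyclic over `𝒪_F` (and killed by `1 − u^{[E:F]}`,
  `LubinTateColemanRelativeBaseNormLawsTwo`), i.e. a quotient of `𝒪_F/(1 − u^{[E:F]})` — de Shalit's `(𝒪/p^N)(1)`; along the
  unramified `ℤ_p`-tower of bases these cokernels form a pro-cyclic, hence `ℤ_p⟦T₁,T₂⟧`-pseudo-null, system.

## References

* E. de Shalit, *Iwasawa theory of elliptic curves with complex multiplication* (1987), Ch. I §3.7 Theorem, §3.14. [deShalit1987]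
* J.-P. Serre, *Local Fields* (1979), Ch. II §3 (complete filtered modules). [SerreLocalFields1979]
-/

noncomputable section

open scoped PowerSeries.WithPiTopology

namespace Literature.NumberTheory.GaloisRepresentations

/-! ### Adic Cauchy sequences -/

/-- **`I`-adic Cauchy sequences converge** in an `I`-adically precomplete ring: if `t_{n+1} − t_n ∈ I^n` for all `n` there is `L`
with `L − t_n ∈ I^n` for all `n`. [cite: SerreLocalFields1979, Ch. II §3] -/
theorem exists_forall_sub_mem_pow {S : Type*} [CommRing S] (I : Ideal S) [IsPrecomplete I S] (t : ℕ → S)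
    (ht : ∀ n, t (n + 1) - t n ∈ I ^ n) : ∃ L : S, ∀ n, L - t n ∈ I ^ n := by
  have hle : ∀ {n m : ℕ}, n ≤ m → t m - t n ∈ I ^ n := by
    intro n m hnm
    induction m, hnm using Nat.le_induction with
    | base => rw [sub_self]; exact zero_mem _
    | succ m hnm ih =>
      have e : t (m + 1) - t n = (t (m + 1) - t m) + (t m - t n) := by ring
      rw [e]
      exact add_mem (Ideal.pow_le_pow_right (I := I) hnm (ht m)) ih
  obtain ⟨L, hL⟩ : ∃ L : S, ∀ n, t n ≡ L [SMOD (I ^ n • ⊤ : Submodule S S)] :=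
    IsPrecomplete.prec' t fun {m n} hmn => by
      rw [SModEq.sub_mem, smul_eq_mul, Ideal.mul_top, ← neg_sub, neg_mem_iff]
      exact hle hmn
  refine ⟨L, fun n => ?_⟩
  have h := hL n
  rw [SModEq.sub_mem, smul_eq_mul, Ideal.mul_top, ← neg_sub, neg_mem_iff] at h
  exact h

section AnomalyCokernel

open GaloisRepresentations.IsNonarchimedeanLocalField LubinTate ValuativeRel Field

variable {F : Type} [Field F] [ValuativeRel F] [TopologicalSpace F] [IsNonarchimedeanLocalField F]

attribute [local instance] ltNormUniformSpace ltNormIsUniformAddGroup rk1 nF nE fintypeResidueField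

variable {π : 𝒪[F]} (hπ : (valuation F).IsUniformizer (π : F))
variable (E : IntermediateField F (AlgebraicClosure F)) [FiniteDimensional F E]

/-! ### `𝒪_E/π𝒪_E` is finite; `a^q ≡ a (mod 𝔪_F)` -/

include hπ in
/-- **`𝒪_E/π𝒪_E` is finite** for `E ⊆ F^{nr}` finite (`𝒪_E` is compact and `π𝒪_E = {‖x‖ < 1}` is open).
[cite: SerreLocalFields1979, Ch. II §1 Prop. 1] -/
theorem finite_quotient_span_pi (hE : E ≤ maxUnramified F) :
    Finite (unitBall E ⧸ Ideal.span {algebraMap 𝒪[F] (unitBall E) π}) := by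
  haveI := compactSpace_unitBall E
  have hopen : IsOpen (((Ideal.span {algebraMap 𝒪[F] (unitBall E) π}).toAddSubgroup : AddSubgroup (unitBall E)) :
      Set (unitBall E)) := by
    have e : (((Ideal.span {algebraMap 𝒪[F] (unitBall E) π}).toAddSubgroup : AddSubgroup (unitBall E)) : Set (unitBall E)) =
        {x : unitBall E | ‖(x : E)‖ < 1} := by
      ext x
      exact (norm_lt_one_iff_mem_span_algebraMap_pi hπ E hE x).symm
    rw [e]
    exact isOpen_lt (continuous_norm.comp continuous_subtype_val) continuous_const
  exact AddSubgroup.quotient_finite_of_isOpen _ hopen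

omit [ValuativeRel F] [TopologicalSpace F] [IsNonarchimedeanLocalField F] in
/-- **`a^q ≡ a (mod 𝔪_F)`** for `a ∈ 𝒪_F` (`q = |𝓀_F|`). [cite: SerreLocalFields1979, Ch. I §8] -/
theorem pow_residueFieldCard_sub_mem {F : Type} [Field F] [ValuativeRel F] [TopologicalSpace F] [IsNonarchimedeanLocalField F]
    (a : 𝒪[F]) : a ^ residueFieldCard F - a ∈ 𝓂[F] := by
  rw [← Ideal.Quotient.eq_zero_iff_mem, map_sub, map_pow, sub_eq_zero]
  change (IsLocalRing.residue 𝒪[F] a) ^ residueFieldCard F = IsLocalRing.residue 𝒪[F] a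
  rw [residueFieldCard, Nat.card_eq_fintype_card, FiniteField.pow_card]

/-! ### The cokernel modulo `π` -/

include hπ in
set_option maxHeartbeats 800000 in
/-- ★ **Modulo `π` the anomaly cokernel is a line**: for `E ⊆ F^{nr}` finite, `ψ` a ring endomorphism of `𝒪_E` over `𝒪_F` with
`ψ(c) ≡ c^q (mod π)` and `u ∈ 𝒪_F`, there is `c₀` with `𝒪_E = 𝒪_F·c₀ + (1 − uψ)𝒪_E + π𝒪_E` (on the field `𝓀_E = 𝒪_E/π` the kernel of
`1 − ū·Frob_q` is a set of roots of `ūX^q − X`, of size `≤ q = |𝓀_F|`, so the cokernel has `≤ q` elements and is generated over `𝓀_F`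
by any class outside the image). [cite: deShalit1987, Ch. I §3.7 Theorem] -/
theorem exists_forall_exists_sub_mem_span (hE : E ≤ maxUnramified F) {ψ : unitBall E →+* unitBall E}
    (hψa : ∀ a : 𝒪[F], ψ (algebraMap 𝒪[F] (unitBall E) a) = algebraMap 𝒪[F] (unitBall E) a)
    (hψ : ∀ c : unitBall E, ψ c - c ^ residueFieldCard F ∈ Ideal.span {algebraMap 𝒪[F] (unitBall E) π}) (u : 𝒪[F]) :
    ∃ c₀ : unitBall E, ∀ c : unitBall E, ∃ (a : 𝒪[F]) (c' : unitBall E),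
      c - (algebraMap 𝒪[F] (unitBall E) a * c₀ + (c' - algebraMap 𝒪[F] (unitBall E) u * ψ c')) ∈
        Ideal.span {algebraMap 𝒪[F] (unitBall E) π} := by
  classical
  obtain ⟨P, hP⟩ : ∃ P : Ideal (unitBall E), P = Ideal.span {algebraMap 𝒪[F] (unitBall E) π} := ⟨_, rfl⟩
  rw [← hP] at hψ ⊢
  haveI : P.IsPrime := hP ▸ isPrime_span_algebraMap_pi hπ E hE
  have hfinP : Finite (unitBall E ⧸ P) := hP ▸ finite_quotient_span_pi hπ E hE
  -- the reduction `ψ̄` of `ψ` is the `q`-Frobenius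
  have hPψ : P ≤ P.comap ψ := by
    rw [hP, Ideal.span_singleton_le_iff_mem, Ideal.mem_comap, hψa]
    exact Ideal.subset_span rfl
  obtain ⟨ψb, hψb⟩ : ∃ ψb : unitBall E ⧸ P →+* unitBall E ⧸ P, ψb = Ideal.quotientMap P ψ hPψ := ⟨_, rfl⟩
  have hψb_mk : ∀ c, ψb (Ideal.Quotient.mk P c) = Ideal.Quotient.mk P (ψ c) := fun c => by
    rw [hψb, Ideal.quotientMap_mk]
  have hψb_pow : ∀ y, ψb y = y ^ residueFieldCard F := by
    intro y
    obtain ⟨c, rfl⟩ := Ideal.Quotient.mk_surjective y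
    rw [hψb_mk, ← map_pow, Ideal.Quotient.eq]
    exact hψ c
  -- the map `L̄ = 1 − ū ψ̄`
  obtain ⟨U, hU⟩ : ∃ U : unitBall E ⧸ P, U = Ideal.Quotient.mk P (algebraMap 𝒪[F] (unitBall E) u) := ⟨_, rfl⟩
  obtain ⟨L, hL⟩ : ∃ L : (unitBall E ⧸ P) →+ (unitBall E ⧸ P),
      L = AddMonoidHom.id _ - (AddMonoidHom.mulLeft U).comp ψb.toAddMonoidHom := ⟨_, rfl⟩
  have hL_apply : ∀ y, L y = y - U * ψb y := fun y => by rw [hL]; rfl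
  have hL_smul : ∀ (a : 𝒪[F]) (y : unitBall E ⧸ P),
      L (Ideal.Quotient.mk P (algebraMap 𝒪[F] (unitBall E) a) * y) = Ideal.Quotient.mk P (algebraMap 𝒪[F] (unitBall E) a) * L y := by
    intro a y
    rw [hL_apply, hL_apply, map_mul, hψb_mk, hψa]
    ring
  -- (i) `|ker L̄| ≤ q`: the kernel consists of roots of `ūX^q − X`
  have hq1 : 1 < residueFieldCard F := one_lt_residueFieldCard F
  obtain ⟨f, hf⟩ : ∃ f : Polynomial (unitBall E ⧸ P),
      f = Polynomial.C U * Polynomial.X ^ residueFieldCard F - Polynomial.X := ⟨_, rfl⟩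
  have hf0 : f ≠ 0 := by
    intro h
    have h1 := congrArg (fun g : Polynomial (unitBall E ⧸ P) => g.coeff 1) h
    simp only [hf, Polynomial.coeff_sub, Polynomial.coeff_C_mul, Polynomial.coeff_X_pow, Polynomial.coeff_X_one,
      Polynomial.coeff_zero, if_neg hq1.ne, mul_zero, zero_sub, neg_eq_zero, one_ne_zero] at h1
  have hdeg : f.natDegree ≤ residueFieldCard F := by
    rw [hf]
    refine (Polynomial.natDegree_sub_le _ _).trans (max_le (Polynomial.natDegree_C_mul_X_pow_le _ _) ?_)
    exact Polynomial.natDegree_X_le.trans hq1.le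
  have hker : (L.ker : Set (unitBall E ⧸ P)) ⊆ (f.roots.toFinset : Set (unitBall E ⧸ P)) := by
    intro y hy
    rw [SetLike.mem_coe, AddMonoidHom.mem_ker, hL_apply, sub_eq_zero, hψb_pow] at hy
    rw [Finset.mem_coe, Multiset.mem_toFinset, Polynomial.mem_roots hf0, Polynomial.IsRoot.def, hf, Polynomial.eval_sub,
      Polynomial.eval_mul, Polynomial.eval_C, Polynomial.eval_pow, Polynomial.eval_X, ← hy, sub_self]
  have hcardK : Nat.card L.ker ≤ residueFieldCard F := by
    calc Nat.card L.ker ≤ Nat.card (f.roots.toFinset : Set (unitBall E ⧸ P)) := Nat.card_mono (Finset.finite_toSet _) hker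
      _ = f.roots.toFinset.card := by rw [Nat.card_coe_set_eq, Set.ncard_coe_finset]
      _ ≤ Multiset.card f.roots := Multiset.toFinset_card_le _
      _ ≤ f.natDegree := Polynomial.card_roots' f
      _ ≤ residueFieldCard F := hdeg
  -- (ii) `|coker L̄| = |ker L̄| ≤ q`
  have hcardQ : Nat.card ((unitBall E ⧸ P) ⧸ L.range) ≤ Nat.card 𝓀[F] := by
    have h1 := AddSubgroup.card_eq_card_quotient_mul_card_addSubgroup L.ker
    have h2 := AddSubgroup.card_eq_card_quotient_mul_card_addSubgroup L.range
    have h3 : Nat.card ((unitBall E ⧸ P) ⧸ L.ker) = Nat.card L.range :=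
      Nat.card_congr (QuotientAddGroup.quotientKerEquivRange L).toEquiv
    have hfinR : Finite L.range := @Subtype.finite _ hfinP _
    have hpos : 0 < Nat.card L.range := Nat.card_pos_iff.2 ⟨⟨⟨0, L.range.zero_mem⟩⟩, hfinR⟩
    have h4 : Nat.card ((unitBall E ⧸ P) ⧸ L.range) = Nat.card L.ker := by
      apply Nat.eq_of_mul_eq_mul_right hpos
      rw [← h2, h1, h3, mul_comm]
    rw [h4]
    exact hcardK
  -- (iii) a section of the residue map of `𝒪_F`, and cyclicity of the cokernel
  obtain ⟨s, hs⟩ : ∃ s : 𝓀[F] → 𝒪[F], ∀ k, IsLocalRing.residue 𝒪[F] (s k) = k :=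
    ⟨Function.surjInv Ideal.Quotient.mk_surjective, Function.surjInv_eq Ideal.Quotient.mk_surjective⟩
  have key : ∃ c₀b : unitBall E ⧸ P, ∀ x : unitBall E ⧸ P, ∃ a : 𝒪[F],
      x - Ideal.Quotient.mk P (algebraMap 𝒪[F] (unitBall E) a) * c₀b ∈ L.range := by
    by_cases htop : L.range = ⊤
    · exact ⟨0, fun x => ⟨0, by rw [mul_zero, sub_zero, htop]; exact AddSubgroup.mem_top x⟩⟩
    · obtain ⟨x₀, hx₀⟩ : ∃ x₀, x₀ ∉ L.range := by
        by_contra h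
        push Not at h
        exact htop ((AddSubgroup.eq_top_iff' _).mpr h)
      refine ⟨x₀, ?_⟩
      obtain ⟨g, hg⟩ : ∃ g : 𝓀[F] → (unitBall E ⧸ P) ⧸ L.range,
          g = fun k => QuotientAddGroup.mk (Ideal.Quotient.mk P (algebraMap 𝒪[F] (unitBall E) (s k)) * x₀) := ⟨_, rfl⟩
      have hginj : Function.Injective g := by
        intro k₁ k₂ hk
        rw [hg] at hk
        have hmem : (Ideal.Quotient.mk P (algebraMap 𝒪[F] (unitBall E) (s k₂)) -
            Ideal.Quotient.mk P (algebraMap 𝒪[F] (unitBall E) (s k₁))) * x₀ ∈ L.range := by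
          have h1 := QuotientAddGroup.eq.mp hk
          rw [neg_add_eq_sub, ← sub_mul] at h1
          exact h1
        by_contra hne
        have hunit : IsUnit (s k₂ - s k₁) := by
          by_contra hnu
          have hmax : s k₂ - s k₁ ∈ 𝓂[F] := (IsLocalRing.mem_maximalIdeal _).mpr hnu
          apply hne
          have h2 : IsLocalRing.residue 𝒪[F] (s k₂ - s k₁) = 0 := (Ideal.Quotient.eq_zero_iff_mem).mpr hmax
          rw [map_sub, hs, hs, sub_eq_zero] at h2
          exact h2.symm
        obtain ⟨w, hw⟩ := hunit.exists_left_inv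
        apply hx₀
        obtain ⟨y, hy⟩ := hmem
        refine ⟨Ideal.Quotient.mk P (algebraMap 𝒪[F] (unitBall E) w) * y, ?_⟩
        rw [hL_smul, hy, ← mul_assoc, ← map_sub, ← map_mul, ← map_sub, ← map_mul, hw, map_one, map_one, one_mul]
      have hfinQ : Finite ((unitBall E ⧸ P) ⧸ L.range) := @Quotient.finite _ hfinP _
      have hbij := @Function.Injective.bijective_of_nat_card_le _ _ hfinQ _ hginj hcardQ
      intro x
      obtain ⟨k, hk⟩ := hbij.2 (QuotientAddGroup.mk x)
      refine ⟨s k, ?_⟩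
      rw [hg] at hk
      have h1 := QuotientAddGroup.eq.mp hk
      rwa [neg_add_eq_sub] at h1
  obtain ⟨c₀b, hc₀b⟩ := key
  obtain ⟨c₀, rfl⟩ := Ideal.Quotient.mk_surjective c₀b
  refine ⟨c₀, fun c => ?_⟩
  obtain ⟨a, y, hy⟩ := hc₀b (Ideal.Quotient.mk P c)
  obtain ⟨c', rfl⟩ := Ideal.Quotient.mk_surjective y
  refine ⟨a, c', ?_⟩
  rw [← Ideal.Quotient.eq_zero_iff_mem, map_sub, map_add, map_mul, map_sub, map_mul, ← hU, ← hψb_mk, ← hL_apply, hy]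
  ring

/-! ### The cokernel itself: lifting by completeness -/

set_option maxHeartbeats 400000 in
include hπ in
/-- ★★ **The anomaly cokernel is cyclic**: for `E ⊆ F^{nr}` finite, `ψ` a ring endomorphism of `𝒪_E` over `𝒪_F` with
`ψ(c) ≡ c^q (mod π)` and `u ∈ 𝒪_F`, there is `c₀ ∈ 𝒪_E` with **`𝒪_E = 𝒪_F·c₀ + (1 − uψ)𝒪_E`**, i.e. every `c` is
`a·c₀ + (c' − u·ψ(c'))` (`a ∈ 𝒪_F`) — the line modulo `π` lifted by the `π`-adic completeness of `𝒪_E` and the `𝔪`-adic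
completeness of `𝒪_F`.  De Shalit's cokernel `(𝒪_{k'}/p^N)(1)` of Theorem I.3.7 is this module (`ψ = φ`, `u = p^dξ^{-1}`-type).
[cite: deShalit1987, Ch. I §3.7 Theorem] -/
theorem exists_forall_exists_eq_add_sub_mul (hE : E ≤ maxUnramified F) {ψ : unitBall E →+* unitBall E}
    (hψa : ∀ a : 𝒪[F], ψ (algebraMap 𝒪[F] (unitBall E) a) = algebraMap 𝒪[F] (unitBall E) a)
    (hψ : ∀ c : unitBall E, ψ c - c ^ residueFieldCard F ∈ Ideal.span {algebraMap 𝒪[F] (unitBall E) π}) (u : 𝒪[F]) :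
    ∃ c₀ : unitBall E, ∀ c : unitBall E, ∃ (a : 𝒪[F]) (c' : unitBall E),
      c = algebraMap 𝒪[F] (unitBall E) a * c₀ + (c' - algebraMap 𝒪[F] (unitBall E) u * ψ c') := by
  obtain ⟨c₀, h1⟩ := exists_forall_exists_sub_mem_span hπ E hE hψa hψ u
  refine ⟨c₀, fun c => ?_⟩
  obtain ⟨A, hA⟩ : ∃ A : 𝒪[F] →+* unitBall E, A = algebraMap 𝒪[F] (unitBall E) := ⟨_, rfl⟩
  obtain ⟨P, hP⟩ : ∃ P : Ideal (unitBall E), P = Ideal.span {A π} := ⟨_, rfl⟩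
  rw [← hA] at h1 hψa ⊢
  rw [← hP] at h1
  have hψA : ∀ n (y : unitBall E), ψ (A π ^ n * y) = A π ^ n * ψ y := fun n y => by rw [map_mul, map_pow, hψa]
  -- one step with an explicit remainder
  have step : ∀ x : unitBall E, ∃ (a : 𝒪[F]) (c' x' : unitBall E),
      x = A a * c₀ + (c' - A u * ψ c') + A π * x' := by
    intro x
    obtain ⟨a, c', hmem⟩ := h1 x
    rw [hP] at hmem
    obtain ⟨x', hx'⟩ := Ideal.mem_span_singleton'.mp hmem
    exact ⟨a, c', x', by rw [mul_comm] at hx'; rw [hx']; ring⟩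
  choose fa fc fx hstep using step
  -- the recursion and the partial sums
  obtain ⟨xs, hxs0, hxs⟩ : ∃ xs : ℕ → unitBall E, xs 0 = c ∧ ∀ n, xs (n + 1) = fx (xs n) :=
    ⟨fun n => Nat.rec c (fun _ x => fx x) n, rfl, fun _ => rfl⟩
  obtain ⟨α, hα⟩ : ∃ α : ℕ → 𝒪[F], α = fun n => ∑ i ∈ Finset.range n, π ^ i * fa (xs i) := ⟨_, rfl⟩
  obtain ⟨S, hS⟩ : ∃ S : ℕ → unitBall E, S = fun n => ∑ i ∈ Finset.range n, A π ^ i * fc (xs i) := ⟨_, rfl⟩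
  have hinv : ∀ n, c = A (α n) * c₀ + (S n - A u * ψ (S n)) + A π ^ n * xs n := by
    intro n
    induction n with
    | zero => simp [hα, hS, hxs0]
    | succ n ih =>
      have hs := hstep (xs n)
      have eα : A (α (n + 1)) = A (α n) + A π ^ n * A (fa (xs n)) := by
        rw [hα]; simp only [Finset.sum_range_succ, map_add, map_mul, map_pow]
      have eS : S (n + 1) = S n + A π ^ n * fc (xs n) := by rw [hS]; simp only [Finset.sum_range_succ]
      rw [eα, eS, map_add, hψA, hxs n, pow_succ]
      linear_combination ih + A π ^ n * hs
  -- the Cauchy conditions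
  have hαC : ∀ n, α (n + 1) - α n ∈ 𝓂[F] ^ n := by
    intro n
    rw [hα]
    simp only [Finset.sum_range_succ, add_sub_cancel_left]
    rw [mem_maximalIdeal_pow_iff hπ]
    exact Dvd.intro _ rfl
  have hSC : ∀ n, S (n + 1) - S n ∈ P ^ n := by
    intro n
    rw [hS]
    simp only [Finset.sum_range_succ, add_sub_cancel_left]
    rw [hP, Ideal.span_singleton_pow]
    exact Ideal.mul_mem_right _ _ (Ideal.mem_span_singleton_self _)
  haveI hc : IsAdicComplete P (unitBall E) := hP ▸ hA ▸ isAdicComplete_span_algebraMap_pi hπ E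
  obtain ⟨αL, hαL⟩ := exists_forall_sub_mem_pow 𝓂[F] α hαC
  obtain ⟨SL, hSL⟩ := exists_forall_sub_mem_pow P S hSC
  refine ⟨αL, SL, ?_⟩
  -- the difference lies in every `P^n`
  rw [← sub_eq_zero]
  refine IsHausdorff.haus' (I := P) _ fun n => ?_
  rw [SModEq.sub_mem, sub_zero, smul_eq_mul, Ideal.mul_top]
  have e : c - (A αL * c₀ + (SL - A u * ψ SL)) =
      A π ^ n * xs n - (A (αL - α n) * c₀ + ((SL - S n) - A u * ψ (SL - S n))) := by
    have h := hinv n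
    rw [map_sub, map_sub]
    linear_combination h
  rw [e]
  have hPn : A π ^ n ∈ P ^ n := by rw [hP, Ideal.span_singleton_pow]; exact Ideal.mem_span_singleton_self _
  have hmapn : ∀ x : 𝒪[F], x ∈ 𝓂[F] ^ n → A x ∈ P ^ n := by
    intro x hx
    obtain ⟨y, rfl⟩ := (mem_maximalIdeal_pow_iff hπ).mp hx
    rw [map_mul, map_pow]
    exact Ideal.mul_mem_right _ _ hPn
  have hψn : ∀ x : unitBall E, x ∈ P ^ n → ψ x ∈ P ^ n := by
    intro x hx
    rw [hP, Ideal.span_singleton_pow] at hx ⊢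
    obtain ⟨y, rfl⟩ := Ideal.mem_span_singleton'.mp hx
    rw [map_mul, map_pow, hψa]
    exact Ideal.mul_mem_left _ _ (Ideal.mem_span_singleton_self _)
  refine sub_mem (Ideal.mul_mem_right _ _ hPn) (add_mem (Ideal.mul_mem_right _ _ (hmapn _ (hαL n)))
    (sub_mem (hSL n) (Ideal.mul_mem_left _ _ (hψn _ (hSL n)))))

/-! ### `q = 2`: the cokernel of `β ↦ r_β` is cyclic over `𝒪_F` -/

variable [Normal F E] [IsGalois F E] (hq : residueFieldCard F = 2) (hE : E ≤ maxUnramified F)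
  {σ₀ : absoluteGaloisGroup F} (hσ₀ : IsAbsArithFrob σ₀)

/-- ★★ **The cokernel of Theorem I.3.7 is a cyclic `𝒪_F`-module** (`q = 2`, `π = 2u`, `π ≡ m₁ (mod π²)`, `E ⊆ F^{nr}` finite Galois
with Frobenius `φ`): there is `c₀ ∈ 𝒪_E` such that every `r ∈ 𝒪_E⟦Y⟧` is `C(a·c₀) + r_β` for some `a ∈ 𝒪_F` and some PRINCIPAL
norm-coherent unit `β` along `E·K_π^∞` — `𝒪_E⟦Y⟧ = 𝒪_F·C(c₀) + r(𝒰¹)`.  With `exists_principal_relUnitCoordTwo_eq_of_constantCoeff_eq`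
(the cokernel is killed by `1 − u^{[E:F]}`) it is a quotient of `𝒪_F/(1 − u^{[E:F]})`: de Shalit's `(𝒪/p^N)(1)`.
[cite: deShalit1987, Ch. I §3.7 Theorem] -/
theorem exists_principal_relUnitCoordTwo_eq_sub_C (u : (LTCoeff F)ˣ) (hu : LTCoeff.of F π = residueFieldCard F * u)
    (hm : ∃ m₁ : ℕ, LTCoeff.of F π ^ 2 ∣ LTCoeff.of F π - m₁) :
    ∃ c₀ : unitBall E, ∀ r : PowerSeries (unitBall E), ∃ (a : 𝒪[F]) (β : RelNormCoherentUnits hπ E),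
      ‖((β.val 0 : unitBall (E ⊔ ltField π 0 : IntermediateField F (AlgebraicClosure F))) :
        (E ⊔ ltField π 0 : IntermediateField F (AlgebraicClosure F))) - 1‖ < 1 ∧
      relUnitCoordTwo hπ E hq hE hσ₀ u hu β = r - PowerSeries.C (algebraMap 𝒪[F] (unitBall E) a * c₀) := by
  have hψ : ∀ c : unitBall E, (frobUnitBall E σ₀ : unitBall E →+* unitBall E) c - c ^ residueFieldCard F ∈
      Ideal.span {algebraMap 𝒪[F] (unitBall E) π} := fun c => by
    rw [hq]; exact frobUnitBall_sub_sq_mem hπ E hq hE hσ₀ c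
  obtain ⟨c₀, hc₀⟩ := exists_forall_exists_eq_add_sub_mul hπ E hE (ψ := (frobUnitBall E σ₀ : unitBall E →+* unitBall E))
    (fun a => unitBallEquiv_algebraMap E _ a) hψ ((LTCoeff.of F).symm (u : LTCoeff F))
  refine ⟨c₀, fun r => ?_⟩
  obtain ⟨a, c', hc'⟩ := hc₀ (PowerSeries.constantCoeff r)
  obtain ⟨β, hβ1, hβ⟩ := exists_principal_relUnitCoordTwo_eq hπ E hq hE hσ₀ u hu hm
    (r - PowerSeries.C (algebraMap 𝒪[F] (unitBall E) a * c₀)) c' (by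
      rw [map_sub, PowerSeries.constantCoeff_C, hc']
      change _ = c' - algebraMap 𝒪[F] (unitBall E) ((LTCoeff.of F).symm (u : LTCoeff F)) * _
      ring)
  exact ⟨a, β, hβ1, hβ⟩

end AnomalyCokernel

end Literature.NumberTheory.GaloisRepresentations
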